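import Summits.CriticalPhenomena.SAWScalingLimit.Theorems.SAWDevelopingMapObservableToSLETypeLadderCarvedReductionSqueezeSelection
import Summits.CriticalPhenomena.SAWScalingLimit.Theorems.SAWDevelopingMapObservableToSLETypeLadderCarvedReductionSqueezeLattice2
import Summits.CriticalPhenomena.SAWScalingLimit.Theorems.SAWDevelopingMapObservableToSLETypeLadderCarvedReductionSqueezeDomainsCoreF
import Summits.CriticalPhenomena.SAWScalingLimit.Theorems.SAWDevelopingMapObservableToSLETypeLadderCarvedReductionSqueezeConfinedOuterHull
import Summits.CriticalPhenomena.SAWScalingLimit.Theorems.SAWDevelopingMapObservableToSLETypeLadderCarvedReductionSqueezeRatio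
import Summits.CriticalPhenomena.SAWScalingLimit.Theorems.SAWDefectDecoherenceObservableToSLERResidueAssemblyMacro
import HarnessLib

/-!
# Crux `SAWDevelopingMap.ObservableToSLE` (stmt-CriticalPhenomena-10472), line `six-class-type-ladder`:
# T2b″ CLOSED and THE CRUX CLOSED MODULO ITS THREE RESEARCH ITEMS

Landing target:
`Summits/CriticalPhenomena/SAWScalingLimit/Theorems/SAWDevelopingMapObservableToSLETypeLadderResidue.lean`
(`--supports stmt-CriticalPhenomena-10472`; lead prover-line-stmt-CriticalPhenomena-10472-c5-0; registered carrier
`stub_carvedReduction_squeezeSolid_radii`).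

* `carvedReduction_squeezeSolid` — **T2b″, THE SOLID MOVING-CARVING SQUEEZE from the two-piece admissible restriction limit**
  (`TwoPieceAdmRestrictionLimit → MovingCarvingSqueezeP FatAnchoredClassZeroSolid`, both inlined; the registered leaf
  `stub_carvedReduction_squeezeSolid` of skeletons r6–r13 and of the twin crux stmt-CriticalPhenomena-14005, same text — its header
  exceeds the gate's 3 900 stored characters, hence the plain name): GLUE over T-A (inlined; = `carvedReduction_squeezeGeometry` p163006: STAGE 1a
  p137830, STAGE 1b p162460 ∘ p147799, STAGE 2′ p154374) and T-B `stub_carvedReduction_ratioSqueeze` (p131716: ARL″ once in the outer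
  approximant + the exact sandwich).
* `observableToSLE_of_residue` — **THE CRUX FROM ITS RESIDUE, kernel-checked**: `ObservableToSLE` (= DCS Conjecture 1 from the
  observable limit `R` and tightness, written out) from EXACTLY three research-grade lattice inputs, all EXISTING ledger items:
  (S1) nested renewal with fat co-oriented solid tame families, locality scale bounded — item stmt-CriticalPhenomena-17698 verbatim
  (the abundance of good gates; the only input not implied, in substance, by Conjecture 1); (T1⁻) MACROSCOPIC source locality —
  implied by item stmt-CriticalPhenomena-17689 (`Macro.macroSourceLocality_of_twoPieceSourceLocality`, p145850); (T5ₐ) simplicity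
  of subsequential limits — item stmt-CriticalPhenomena-7148 `SAWLatticeVirasoro.HexSimpleSubseqLimits` by name.  Proof: the twin
  crux's landed residue assembly `Residue.observableToSLER_of_residueMacro` (the two cruxes are one statement,
  `Residue.observableToSLER_iff_observableToSLE`) fed with `carvedReduction_squeezeSolid`.
So the line `six-class-type-ladder` (skeleton r13, `Cruxes/ObservableToSLE/Lines/six_class_type_ladder.lean`) ends with the crux
reduced, in the tree, to {17698, 17689 (weakened to T1⁻), 7148}.
-/

noncomputable section

open scoped BigOperators Topology NNReal ENNReal Classical BoundedContinuousFunction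
open Filter Set MeasureTheory Metric
open Literature.Probability.LatticeModels (HexVertex hexGraph hexCenter triZeta triEmbed Site polyline)
open Literature.Probability.RandomPlanarGeometry
open Literature.Probability.RandomPlanarGeometry.SAW
open UpperHalfPlane (upperHalfPlaneSet)

namespace Summit.CriticalPhenomena.SAWScalingLimit.Theorems.ObservableToSLE.TypeLadder

open Summit.CriticalPhenomena.SAWScalingLimit.Theses.SAWDevelopingMap (HexObservableLimit HexTight ObservableToSLE)
open Summit.CriticalPhenomena.SAWScalingLimit.Theorems.ObservableToSLER.BridgeGate
open Summit.CriticalPhenomena.SAWScalingLimit.Theorems.ObservableToSLER.NestedGate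

/-- **Registered carrier `stub_carvedReduction_squeezeSolid_radii`** (crux item stmt-CriticalPhenomena-10472, leaf T2b″): the flat
radius `ρ/128` of the assembled squeeze is positive and at most the box half-width `ρ/64`. -/
theorem stub_carvedReduction_squeezeSolid_radii :
    ∀ ρ : ℝ, 0 < ρ → (0 : ℝ) < ρ / 128 ∧ ρ / 128 ≤ ρ / 64 := by
  intro ρ hρ
  constructor
  · positivity
  · linarith

/-- **T2b″ `carvedReduction_squeezeSolid` — the solid moving-carving squeeze from the two-piece admissible restriction limit**
(see the module docstring); GLUE over T-A and T-B. -/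
theorem carvedReduction_squeezeSolid :
    (∀ (D D' : DobrushinDomain) (ρ : ℝ) (φ : ConformalEquiv upperHalfPlaneSet D.carrier)
      (Φ : ConformalEquiv (upperHalfPlaneSet \ φ.pullbackHull D') upperHalfPlaneSet) (d : ℝ)
      (Λ Λ' : ℝ → Finset HexVertex) (m₀ m₁ m₁' : ℝ → ℤ) (a b : ℝ → Sym2 HexVertex),
      (0 < ρ ∧ ∀ i : Fin 2, D.carrier ∩ ball (D.pt i) ρ = {z : ℂ | (D.pt i).im < z.im} ∩ ball (D.pt i) ρ) →
      D.IsHullSubdomain D' → D.IsChordalUniformizing φ →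
      IsRestrictionMap (φ.pullbackHull D') Φ → HasRestrictionDeriv (φ.pullbackHull D') Φ d →
      (∀ᶠ δ : ℝ in 𝓝[>] 0,
        Λ' δ ⊆ Λ δ ∧ hexDomainSimplyConnected (Λ δ) ∧ hexDomainSimplyConnected (Λ' δ) ∧
        (hexGraph.induce (↑(Λ δ) : Set HexVertex)).Preconnected ∧
        (hexGraph.induce (↑(Λ' δ) : Set HexVertex)).Preconnected ∧
        a δ ∈ hexDomainBoundary (Λ δ) ∧ b δ ∈ hexDomainBoundary (Λ δ) ∧
        a δ ∈ hexDomainBoundary (Λ' δ) ∧ b δ ∈ hexDomainBoundary (Λ' δ) ∧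
        Nonempty (HexMidEdgeSAW (Λ' δ) (a δ) (b δ)) ∧
        (∀ v ∈ Λ δ, (δ : ℂ) * hexCenter v ∈ D.carrier) ∧
        (∀ v ∈ Λ' δ, (δ : ℂ) * hexCenter v ∈ D'.carrier) ∧
        (∀ v : HexVertex, (δ : ℂ) * hexCenter v ∈ ball (D.pt 0) ρ →
          ((v ∈ Λ δ ↔ m₀ δ ≤ v.1 1) ∧ (v ∈ Λ' δ ↔ m₀ δ ≤ v.1 1))) ∧
        (∀ v : HexVertex, (δ : ℂ) * hexCenter v ∈ ball (D.pt 1) ρ →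
          ((v ∈ Λ δ ↔ m₁ δ ≤ v.1 1) ∧ (v ∈ Λ' δ ↔ m₁' δ ≤ v.1 1)))) →
      (∀ K : Set ℂ, IsCompact K → K ⊆ D.carrier →
        ∀ᶠ δ : ℝ in 𝓝[>] 0, ∀ v : HexVertex, (δ : ℂ) * hexCenter v ∈ K → v ∈ Λ δ) →
      (∀ K : Set ℂ, IsCompact K → K ⊆ D'.carrier →
        ∀ᶠ δ : ℝ in 𝓝[>] 0, ∀ v : HexVertex, (δ : ℂ) * hexCenter v ∈ K → v ∈ Λ' δ) →
      Tendsto (fun δ : ℝ => (δ : ℂ) * hexMidpoint (a δ)) (𝓝[>] 0) (𝓝 (D.pt 0)) →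
      Tendsto (fun δ : ℝ => (δ : ℂ) * hexMidpoint (b δ)) (𝓝[>] 0) (𝓝 (D.pt 1)) →
      Tendsto (fun δ : ℝ =>
          (∑ γ : HexMidEdgeSAW (Λ' δ) (a δ) (b δ), hexCriticalFugacity ^ γ.length) /
            (∑ γ : HexMidEdgeSAW (Λ δ) (a δ) (b δ), hexCriticalFugacity ^ γ.length)) (𝓝[>] 0)
        (𝓝 (d ^ ((5 : ℝ) / 8)))) →
    (∀ (D : DobrushinDomain) (a b : ℝ → HexVertex), IsEmbEndpointApprox hexGraph hexCenter D a b →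
      ∀ η > (0 : ℝ), ∃ R₀ > (0 : ℝ), ∀ R ∈ Set.Ioc (0 : ℝ) R₀, ∀ ρ > (0 : ℝ), ∀ N : ℕ,
          ∀ (δ : ℕ → ℝ) (S T : ℕ → ℕ → Set HexVertex) (n n' : ℕ → ℕ) (q q' : ℕ → HexVertex),
            Tendsto δ atTop (𝓝[>] 0) →
            (∀ k, TameNestedFamily (δ k) R N (a (δ k)) (S k) ∧
              TameNestedFamily (δ k) R N (b (δ k)) (T k) ∧
              (((∀ i, ExteriorAnchored D.carrier (δ k) (S k i) (a (δ k))) ∧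
          (∀ i, ExteriorAnchored D.carrier (δ k) (T k i) (b (δ k))) ∧
          (∀ (i : ℕ) (p q : HexVertex), HasCleanWindow D.carrier (δ k) ρ (S k i) p q →
            rowOf 0 q = rowOf 0 p + 1 ∧
              ∀ x : HexVertex, ((δ k : ℝ) : ℂ) * hexCenter x ∈ ball (((δ k : ℝ) : ℂ) * hexCenter q) ρ →
                (x ∈ S k i ↔ rowOf 0 x ≤ rowOf 0 p)) ∧
          (∀ (i : ℕ) (p q : HexVertex), HasCleanWindow D.carrier (δ k) ρ (T k i) p q →
            rowOf 0 q = rowOf 0 p + 1 ∧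
              ∀ x : HexVertex, ((δ k : ℝ) : ℂ) * hexCenter x ∈ ball (((δ k : ℝ) : ℂ) * hexCenter q) ρ →
                (x ∈ T k i ↔ rowOf 0 x ≤ rowOf 0 p))) ∧
          (∀ (i : ℕ) (p q : HexVertex), HasCleanWindow D.carrier (δ k) ρ (S k i) p q →
            ∃ K : Set ℂ, IsCompact K ∧ IsConnected K ∧
              ((δ k : ℝ) : ℂ) * hexCenter q - ((ρ / 2 : ℝ) : ℂ) * Complex.I ∈ K ∧ ((δ k : ℝ) : ℂ) * hexCenter (a (δ k)) ∈ K ∧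
              ∀ v : HexVertex, Metric.infDist (((δ k : ℝ) : ℂ) * hexCenter v) K ≤ ρ / 4 → v ∈ S k i) ∧
          (∀ (i : ℕ) (p q : HexVertex), HasCleanWindow D.carrier (δ k) ρ (T k i) p q →
            ∃ K : Set ℂ, IsCompact K ∧ IsConnected K ∧
              ((δ k : ℝ) : ℂ) * hexCenter q - ((ρ / 2 : ℝ) : ℂ) * Complex.I ∈ K ∧ ((δ k : ℝ) : ℂ) * hexCenter (b (δ k)) ∈ K ∧
              ∀ v : HexVertex, Metric.infDist (((δ k : ℝ) : ℂ) * hexCenter v) K ≤ ρ / 4 → v ∈ T k i) ∧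
          (∀ i : ℕ, ∃ K : Set ℂ, IsCompact K ∧ IsConnected K ∧ ((δ k : ℝ) : ℂ) * hexCenter (a (δ k)) ∈ K ∧
            (∀ v : HexVertex, Metric.infDist (((δ k : ℝ) : ℂ) * hexCenter v) K ≤ ρ / 8 → v ∈ S k i) ∧
            (∀ v ∈ S k i, ∃ (t w : HexVertex) (r : ℕ), v ∈ hexBall t r ∧ w ∈ hexBall t r ∧
              hexBall t r ⊆ S k i ∧ Metric.infDist (((δ k : ℝ) : ℂ) * hexCenter w) K ≤ ρ / 16)) ∧
          (∀ i : ℕ, ∃ K : Set ℂ, IsCompact K ∧ IsConnected K ∧ ((δ k : ℝ) : ℂ) * hexCenter (b (δ k)) ∈ K ∧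
            (∀ v : HexVertex, Metric.infDist (((δ k : ℝ) : ℂ) * hexCenter v) K ≤ ρ / 8 → v ∈ T k i) ∧
            (∀ v ∈ T k i, ∃ (t w : HexVertex) (r : ℕ), v ∈ hexBall t r ∧ w ∈ hexBall t r ∧
              hexBall t r ⊆ T k i ∧ Metric.infDist (((δ k : ℝ) : ℂ) * hexCenter w) K ≤ ρ / 16)))) →
            (∀ k, ∃ (γ : HexDomainSAW D.carrier (δ k) (a (δ k)) (b (δ k))) (m : ℕ) (p : HexVertex)
                (m' : ℕ) (p' : HexVertex),
              IsFirstGoodGateN D.carrier (δ k) ρ R (S k) (a (δ k)) γ.walk.support (n k) m p (q k) ∧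
              IsFirstGoodGateN D.carrier (δ k) ρ R (T k) (b (δ k)) γ.walk.support.reverse
                (n' k) m' p' (q' k) ∧
              WideLink D.carrier (δ k) ρ (S k (n k) ∪ T k (n' k)) (q k) (q' k)) →
            ∀ ε' > (0 : ℝ), ∀ φ : ℕ → ℕ, StrictMono φ →
              ∃ (ψ : ℕ → ℕ) (M : DobrushinDomain) (τ : ℂ) (ρ' : ℝ) (Λ' : ℝ → Finset HexVertex)
                (m : Fin 2 → ℝ → ℤ) (a' b' : ℝ → Sym2 HexVertex) (x : ℕ → Site 2)
                (Λ'' : ℕ → Finset HexVertex) (pu pv : ℕ → HexVertex),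
                StrictMono ψ ∧
                (∀ t : ℝ, dist (M.boundary t + τ) (D.boundary t) ≤ η) ∧
                dist (M.pt 0 + τ) (D.pt 0) ≤ η ∧ dist (M.pt 1 + τ) (D.pt 1) ≤ η ∧
                (0 < ρ' ∧ ∀ i : Fin 2,
                  M.carrier ∩ ball (M.pt i) ρ' = {z : ℂ | (M.pt i).im < z.im} ∩ ball (M.pt i) ρ') ∧
                (∀ᶠ δ' : ℝ in 𝓝[>] 0, hexDomainSimplyConnected (Λ' δ') ∧
                  a' δ' ∈ hexDomainBoundary (Λ' δ') ∧ b' δ' ∈ hexDomainBoundary (Λ' δ') ∧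
                  Nonempty (HexMidEdgeSAW (Λ' δ') (a' δ') (b' δ')) ∧
                  (hexGraph.induce (↑(Λ' δ') : Set HexVertex)).Preconnected ∧
                  (∀ v ∈ Λ' δ', (δ' : ℂ) * hexCenter v ∈ M.carrier) ∧
                  (∀ i : Fin 2, ∀ v : HexVertex, (δ' : ℂ) * hexCenter v ∈ ball (M.pt i) ρ' →
                    (v ∈ Λ' δ' ↔ m i δ' ≤ v.1 1))) ∧
                (∀ K : Set ℂ, IsCompact K → K ⊆ M.carrier →
                  ∀ᶠ δ' : ℝ in 𝓝[>] 0, ∀ v : HexVertex, (δ' : ℂ) * hexCenter v ∈ K → v ∈ Λ' δ') ∧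
                Tendsto (fun δ' : ℝ => (δ' : ℂ) * hexMidpoint (a' δ')) (𝓝[>] 0) (𝓝 (M.pt 0)) ∧
                Tendsto (fun δ' : ℝ => (δ' : ℂ) * hexMidpoint (b' δ')) (𝓝[>] 0) (𝓝 (M.pt 1)) ∧
                Tendsto (fun j : ℕ => ((δ (φ (ψ j)) : ℝ) : ℂ) *
                  Literature.Probability.LatticeModels.triEmbed (x j)) atTop (𝓝 τ) ∧
                (∀ j : ℕ,
                  (∀ w : HexVertex, w ∈ Λ'' j ↔ ((-(x j) + w.1, w.2) : HexVertex) ∈ Λ' (δ (φ (ψ j)))) ∧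
                  (∀ w ∈ Λ'' j, w ∉ S (φ (ψ j)) (n (φ (ψ j))) ∪ T (φ (ψ j)) (n' (φ (ψ j)))) ∧
                  (∀ w ∈ Λ'' j, ∀ y ∈ Λ'' j, hexGraph.Adj w y →
                    (hexDomainGraph D.carrier (δ (φ (ψ j)))).Adj w y) ∧
                  q (φ (ψ j)) ∈ Λ'' j ∧
                  pu j ∈ S (φ (ψ j)) (n (φ (ψ j))) ∪ T (φ (ψ j)) (n' (φ (ψ j))) ∧
                  pv j ∈ S (φ (ψ j)) (n (φ (ψ j))) ∪ T (φ (ψ j)) (n' (φ (ψ j))) ∧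
                  hexGraph.Adj (q (φ (ψ j))) (pu j) ∧
                  s(q (φ (ψ j)), pu j) ≠ s(q' (φ (ψ j)), pv j) ∧
                  (a' (δ (φ (ψ j)))).map (fun w : HexVertex => ((x j + w.1, w.2) : HexVertex)) =
                    s(q (φ (ψ j)), pu j) ∧
                  (b' (δ (φ (ψ j)))).map (fun w : HexVertex => ((x j + w.1, w.2) : HexVertex)) =
                    s(q' (φ (ψ j)), pv j)) ∧
                (∀ᶠ j : ℕ in atTop, 1 - ε' ≤
                  (carvedLaw D.carrier (δ (φ (ψ j))) (S (φ (ψ j)) (n (φ (ψ j))) ∪ T (φ (ψ j)) (n' (φ (ψ j))))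
                    (q (φ (ψ j))) (q' (φ (ψ j))) {ξ | ∀ w ∈ ξ.walk.support, w ∈ Λ'' j}).toReal)) := by
  intro hARL D a b hab η hη
  -- T-A inlined (= `carvedReduction_squeezeGeometry`, p163006): STAGE 1a, STAGE 1b, STAGE 2′
  obtain ⟨Ra, hRa, hsel⟩ := carvedReduction_squeezeGeometry_selection D a b hab
  obtain ⟨Rb, hRb, hdom⟩ :=
    carvedReduction_squeezeGeometry_domainsCoreF stub_carvedReduction_confinedOuterHull D a b hab η hη
  refine ⟨min Ra Rb, lt_min hRa hRb, fun R hR ρ hρ N δ S T n n' q q' hδ hfam hgates ε' hε' φ hφ => ?_⟩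
  obtain ⟨ψ₀, x₀, τ₀, P₀, P₁, hfacts⟩ :=
    hsel R ⟨hR.1, hR.2.trans (min_le_left _ _)⟩ ρ hρ N δ S T n n' q q' hδ hfam hgates φ hφ
  obtain ⟨ψ₁, E₁, M₁, τ₁, x₁, φE₁, Φ₁, d₁, ρw, ρc, ρc', ρF, hψ₀, hsanti, hspos, hs0, hτ, hM, hbd, hbd0, hbd1,
    hflat₁, hB, hρc, hρc', hρF, hFc, hFc', hFw, hsep, hφE₁, hΦ₁, hd₁, hlev₁, hq0, hq1, hconv0, hconv1,
    habove0, habove1, hU0, hU1, hMD, hMU, hreach, hqdom, hprob⟩ :=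
    hdom R ⟨hR.1, hR.2.trans (min_le_right _ _)⟩ ρ hρ N δ S T n n' q q' hδ hfam hgates ε' hε' φ hφ
      ψ₀ x₀ τ₀ P₀ P₁ hfacts
  obtain ⟨ψ, M, τ, ρ', Λ', m, a', b', x, Λ'', pu, pv, h1, h2, h3, h4, h5, h6, h7, h8, h9, h10, h11,
    E, ρE, φE, Φ, d, Nf, m₀, m₁, m₁', hflat, hHull, hφE, hΦ, hd, hlev, hadm, hexhE, hexhM, haE, hbE, hcell⟩ :=
    carvedReduction_squeezeGeometry_lattice2 D δ S T n n' q q' η ε' φ ψ₁ E₁ M₁ τ₁ x₁ φE₁ Φ₁ d₁ ρw ρc ρc' ρF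
      hψ₀ hsanti hspos hs0 hτ hM hbd hbd0 hbd1 hflat₁ hB hρc hρc' hρF hFc hFc' hFw hsep hφE₁ hΦ₁ hd₁ hlev₁ hq0 hq1
      hconv0 hconv1 habove0 habove1 hU0 hU1 hMD hMU hreach hqdom hprob
  refine ⟨ψ, M, τ, ρ', Λ', m, a', b', x, Λ'', pu, pv, h1, h2, h3, h4, h5, h6, h7, h8, h9, h10, h11, ?_⟩
  exact stub_carvedReduction_ratioSqueeze hARL D.carrier (fun j => δ (φ (ψ j)))
    (fun j => S (φ (ψ j)) (n (φ (ψ j))) ∪ T (φ (ψ j)) (n' (φ (ψ j)))) (fun j => q (φ (ψ j)))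
    (fun j => q' (φ (ψ j))) pu pv x Λ'' E M ρE φE Φ d Nf Λ' m₀ m₁ m₁' a' b' ε' D.isBounded
    (hδ.comp (hφ.comp h1).tendsto_atTop) hflat hHull hφE hΦ hd hlev hadm hexhE hexhM haE hbE hcell

/-- **THE CRUX FROM ITS RESIDUE (kernel-checked).**  `ObservableToSLE` from (S1) = item stmt-CriticalPhenomena-17698 verbatim,
(T1⁻) macroscopic source locality (⇐ item stmt-CriticalPhenomena-17689), (T5ₐ) = item stmt-CriticalPhenomena-7148 by name; everything
else — gate renewal transfer, co-oriented solid reduction, the two-piece identification, the solid moving-carving squeeze, the modulus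
from tightness and simple limits, the identification criterion — is landed. -/
theorem observableToSLE_of_residue
    (h2 :
      ∀ (D : DobrushinDomain) (a b : ℝ → HexVertex), IsEmbEndpointApprox hexGraph hexCenter D a b →
        ∀ ε > (0 : ℝ), ∃ R₂ > (0 : ℝ), ∀ R ∈ Set.Ioc (0 : ℝ) R₂, ∃ ρ > (0 : ℝ), ∃ N : ℕ, ∀ᶠ δ : ℝ in 𝓝[>] 0,
          ∃ S T : ℕ → Set HexVertex,
            TameNestedFamily δ R N (a δ) S ∧ TameNestedFamily δ R N (b δ) T ∧
            ((∀ n, ExteriorAnchored D.carrier δ (S n) (a δ)) ∧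
              (∀ n, ExteriorAnchored D.carrier δ (T n) (b δ)) ∧
              ∃ j : Fin 6,
                ((∀ (n : ℕ) (p q : HexVertex), HasCleanWindow D.carrier δ ρ (S n) p q →
                    rowOf j q = rowOf j p + 1 ∧
                      ∀ x : HexVertex, (δ : ℂ) * hexCenter x ∈ ball ((δ : ℂ) * hexCenter q) ρ →
                        (x ∈ S n ↔ rowOf j x ≤ rowOf j p)) ∧
                  (∀ (n : ℕ) (p q : HexVertex), HasCleanWindow D.carrier δ ρ (T n) p q →
                    rowOf j q = rowOf j p + 1 ∧
                      ∀ x : HexVertex, (δ : ℂ) * hexCenter x ∈ ball ((δ : ℂ) * hexCenter q) ρ →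
                        (x ∈ T n ↔ rowOf j x ≤ rowOf j p))) ∧
                (∀ (n : ℕ) (p q : HexVertex), HasCleanWindow D.carrier δ ρ (S n) p q →
                  ∃ K : Set ℂ, IsCompact K ∧ IsConnected K ∧
                    (δ : ℂ) * hexCenter q - ((ρ / 2 : ℝ) : ℂ) * Complex.I * triZeta ^ (j : ℕ) ∈ K ∧
                    (δ : ℂ) * hexCenter (a δ) ∈ K ∧
                    ∀ v : HexVertex, Metric.infDist ((δ : ℂ) * hexCenter v) K ≤ ρ / 4 → v ∈ S n) ∧
                (∀ (n : ℕ) (p q : HexVertex), HasCleanWindow D.carrier δ ρ (T n) p q →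
                  ∃ K : Set ℂ, IsCompact K ∧ IsConnected K ∧
                    (δ : ℂ) * hexCenter q - ((ρ / 2 : ℝ) : ℂ) * Complex.I * triZeta ^ (j : ℕ) ∈ K ∧
                    (δ : ℂ) * hexCenter (b δ) ∈ K ∧
                    ∀ v : HexVertex, Metric.infDist ((δ : ℂ) * hexCenter v) K ≤ ρ / 4 → v ∈ T n) ∧
                (∀ n : ℕ, ∃ K : Set ℂ, IsCompact K ∧ IsConnected K ∧ (δ : ℂ) * hexCenter (a δ) ∈ K ∧
                  (∀ v : HexVertex, Metric.infDist ((δ : ℂ) * hexCenter v) K ≤ ρ / 8 → v ∈ S n) ∧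
                  (∀ v ∈ S n, ∃ (t w : HexVertex) (r : ℕ), v ∈ hexBall t r ∧ w ∈ hexBall t r ∧
                    hexBall t r ⊆ S n ∧ Metric.infDist ((δ : ℂ) * hexCenter w) K ≤ ρ / 16)) ∧
                (∀ n : ℕ, ∃ K : Set ℂ, IsCompact K ∧ IsConnected K ∧ (δ : ℂ) * hexCenter (b δ) ∈ K ∧
                  (∀ v : HexVertex, Metric.infDist ((δ : ℂ) * hexCenter v) K ≤ ρ / 8 → v ∈ T n) ∧
                  (∀ v ∈ T n, ∃ (t w : HexVertex) (r : ℕ), v ∈ hexBall t r ∧ w ∈ hexBall t r ∧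
                    hexBall t r ⊆ T n ∧ Metric.infDist ((δ : ℂ) * hexCenter w) K ≤ ρ / 16))) ∧
            hexSAWLaw D.carrier δ (a δ) (b δ)
                {γ | ¬ ∃ (n m : ℕ) (p q : HexVertex) (n' m' : ℕ) (p' q' : HexVertex),
                    IsFirstGoodGateN D.carrier δ ρ R S (a δ) γ.walk.support n m p q ∧
                    IsFirstGoodGateN D.carrier δ ρ R T (b δ) γ.walk.support.reverse n' m' p' q' ∧
                    WideLink D.carrier δ ρ (S n ∪ T n') q q'} ≤
              ENNReal.ofReal ε)
    (h5a1 :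
      ∀ (E : DobrushinDomain) (ρ : ℝ) (Λ : ℝ → Finset HexVertex) (m₀ : ℝ → ℤ)
        (a : ℝ → Sym2 HexVertex),
        0 < ρ → E.carrier ∩ ball (E.pt 0) ρ = {z : ℂ | (E.pt 0).im < z.im} ∩ ball (E.pt 0) ρ →
        (∀ᶠ δ : ℝ in 𝓝[>] 0, hexDomainSimplyConnected (Λ δ) ∧
          (hexGraph.induce (↑(Λ δ) : Set HexVertex)).Preconnected ∧ a δ ∈ hexDomainBoundary (Λ δ) ∧
          (∀ v ∈ Λ δ, (δ : ℂ) * hexCenter v ∈ E.carrier) ∧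
          (∀ v : HexVertex, (δ : ℂ) * hexCenter v ∈ ball (E.pt 0) ρ → (v ∈ Λ δ ↔ m₀ δ ≤ v.1 1))) →
        (∀ K : Set ℂ, IsCompact K → K ⊆ E.carrier →
          ∀ᶠ δ : ℝ in 𝓝[>] 0, ∀ v : HexVertex, (δ : ℂ) * hexCenter v ∈ K → v ∈ Λ δ) →
        Tendsto (fun δ : ℝ => (δ : ℂ) * hexMidpoint (a δ)) (𝓝[>] 0) (𝓝 (E.pt 0)) →
        ∀ ε : ℝ, 0 < ε → ∀ r : ℝ, 0 < r → ∃ t₀ : ℝ, 0 < t₀ ∧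
          ∀ (s : ℝ → Sym2 HexVertex) (t : ℝ), t ≠ 0 → |t| < t₀ →
            (∀ᶠ δ : ℝ in 𝓝[>] 0, s δ ∈ hexDomainBoundary (Λ δ) ∧
              (hexMidpoint (s δ)).im = (hexMidpoint (a δ)).im) →
            Tendsto (fun δ : ℝ => (δ : ℂ) * hexMidpoint (s δ)) (𝓝[>] 0) (𝓝 (E.pt 0 + t)) →
            ∀ᶠ δ : ℝ in 𝓝[>] 0,
              (∑ γ : HexMidEdgeSAW (Λ δ) (a δ) (s δ),
                  if ∃ v ∈ γ.verts, r ≤ dist ((δ : ℂ) * hexCenter v) ((δ : ℂ) * hexMidpoint (a δ))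
                  then hexCriticalFugacity ^ γ.length else 0) ≤
                ε * ∑ γ : HexMidEdgeSAW (Λ δ) (a δ) (s δ), hexCriticalFugacity ^ γ.length)
    (h7148 : Summit.CriticalPhenomena.SAWScalingLimit.Theses.SAWLatticeVirasoro.HexSimpleSubseqLimits) :
    ObservableToSLE :=
  Summit.CriticalPhenomena.SAWScalingLimit.Theorems.ObservableToSLER.Residue.observableToSLER_of_residueMacro
    h2 h5a1 h7148 carvedReduction_squeezeSolid

end Summit.CriticalPhenomena.SAWScalingLimit.Theorems.ObservableToSLE.TypeLadder

end
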